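import Summits.Ventures.PercRepro.RankLevelSetUpChain

/-! # RankLevelSetUpNoQuad — (↑) AT EVERY LEVEL `k ≥ 5` ON COLOOP-FREE MATROIDS OF NULLITY `≤ 4` WITHOUT A SERIES
QUADRUPLE: THE CHAIN WITH THE COLOOP BOUND `2` FROM `#Y ≥ 7` (night-1 g40; dossier §52; on `RankLevelSetUpChain`)

The up-shadow chain of `RankLevelSetUpChain` needs at most `2` coloops of `M✶ | (E ∖ W)` for every through-`b`
bi-independent `W` at the levels `k ≤ j ≤ #E − 2 − k`. For a spanning set `Y` of the rank-`4` dual, three coloops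
force the remaining `#Y − 3` elements to have rank `1`, i.e. to be pairwise parallel; the predecessors excluded this
by forbidding a parallel TRIPLE when `#Y ≥ 6` (`ncard_coloops_add_two_le`). At the levels of the chain for `k ≥ 5`
every complement has `#Y = #E − j ≥ 7` elements, so it suffices to forbid a parallel QUADRUPLE of the dual — a SERIES
QUADRUPLE of `M` (**`NoSeriesQuad`**, **`ncard_coloops_add_two_le_of_no_quad`**, **`bound_two_of_no_quad`**).
Hence **`upAt_of_no_quad`**: (↑) at every level `k ≥ 5` with `2k + 2 ≤ #E` on every coloop-free matroid of nullity
`≤ 4` without a series quadruple — in particular at every element of a matroid all of whose series classes have `≤ 3`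
elements, which is exactly the case `q = 3` that the class-cut reduction of `RankLevelSetUpFiveSeries` left to the
residue (C1): the residue is NOT needed. **`four_le_ncard_seriesClass_of_not_noSeriesQuad`** produces the class of
`≥ 4` elements otherwise. Every declaration has a docstring; imports: the cell's own modules and Mathlib only.
Axioms: standard. -/

namespace PercRepro

open Set Matroid

variable {α : Type}

/-! ## The refined coloop bound from `#Y ≥ ρ + 3` -/

/-- **A set `Y` of nonloops of rank `≤ ρ` with more than `ρ + 2` elements and no four pairwise parallel elements
has at most `ρ − 2` coloops**: the non-coloops `Y'` have `≥ 4` elements, and if they had rank `1` they would be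
pairwise parallel. -/
lemma ncard_coloops_add_two_le_of_no_quad {N : Matroid α} [N.Finite] {Y : Set α} (hYE : Y ⊆ N.E)
    (hnl : ∀ e ∈ Y, N.IsNonloop e)
    (hnq : ∀ p ∈ Y, ∀ q ∈ Y, ∀ r ∈ Y, ∀ s ∈ Y, p ≠ q → p ≠ r → p ≠ s → q ≠ r → q ≠ s → r ≠ s →
      q ∈ N.closure {p} → r ∈ N.closure {p} → s ∉ N.closure {p})
    {ρ : ℕ} (hρ : N.eRk Y ≤ ρ) (hY : ρ + 2 < Y.ncard) :
    {t ∈ Y | t ∉ N.closure (Y \ {t})}.ncard + 2 ≤ ρ := by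
  classical
  set C := {t ∈ Y | t ∉ N.closure (Y \ {t})} with hC
  have hYfin : Y.Finite := N.ground_finite.subset hYE
  have hCY : C ⊆ Y := fun t ht => ht.1
  have hCfin : C.Finite := hYfin.subset hCY
  set Y' := Y \ C with hY'
  have hsplit : Y = Y' ∪ ↑hCfin.toFinset := by
    rw [hCfin.coe_toFinset, Set.sdiff_union_of_subset hCY]
  have hsk : ∀ d ∈ hCfin.toFinset, d ∉ N.closure (Y' ∪ (↑hCfin.toFinset \ {d})) := by
    intro d hd
    rw [hCfin.mem_toFinset] at hd
    intro h
    apply hd.2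
    refine N.closure_subset_closure ?_ h
    rw [hCfin.coe_toFinset]
    intro x hx
    rcases hx with hx | hx
    · exact ⟨hx.1, fun h => hx.2 (by rw [Set.mem_singleton_iff] at h; rw [h]; exact hd)⟩
    · exact ⟨hCY hx.1, hx.2⟩
  have hrk : N.eRk Y = N.eRk Y' + (hCfin.toFinset.card : ℕ∞) := by
    rw [hsplit] at hρ ⊢
    exact eRk_union_eq_add_encard_of_forall_notMem_closure hCfin.toFinset
      (by rw [hCfin.coe_toFinset]; exact hCY.trans hYE) hsk
  have hCcard : hCfin.toFinset.card = C.ncard := (Set.ncard_eq_toFinset_card C hCfin).symm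
  -- the old bound `#C + 1 ≤ ρ`, hence `#Y' ≥ 4`
  have hold : C.ncard + 1 ≤ ρ := ncard_coloops_add_one_le hYE hnl hρ (by omega)
  have hY'card : Y'.ncard = Y.ncard - C.ncard := Set.ncard_sdiff hCY hCfin
  have hY'4 : 3 < Y'.ncard := by omega
  have hY'fin : Y'.Finite := hYfin.subset Set.sdiff_subset
  have hY'E : Y' ⊆ N.E := Set.sdiff_subset.trans hYE
  -- the rank of `Y'` is at least `2`
  have h2 : (2 : ℕ∞) ≤ N.eRk Y' := by
    by_contra hlt
    have hlt2 : N.eRk Y' < 2 := not_le.mp hlt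
    rw [← one_add_one_eq_two] at hlt2
    have hle1 : N.eRk Y' ≤ 1 := Order.le_of_lt_add_one hlt2
    obtain ⟨u, hu⟩ : Y'.Nonempty := by
      rw [← Set.ncard_pos hY'fin]; omega
    have h1 : (1 : ℕ∞) ≤ N.eRk Y' := by
      rw [← (hnl u hu.1).eRk_eq]
      exact N.eRk_mono (Set.singleton_subset_iff.mpr hu)
    have heq : N.eRk Y' = 1 := le_antisymm hle1 h1
    obtain ⟨e, heY', -, hsub⟩ := (Matroid.eRk_eq_one_iff hY'E).mp heq
    -- three further elements of `Y'` are all in `cl {e}`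
    have hrest : 2 < (Y' \ {e}).ncard := by
      rw [Set.ncard_sdiff_singleton_of_mem heY']; omega
    obtain ⟨q, r, s, hq, hr, hs, hqr, hqs, hrs⟩ :=
      (Set.two_lt_ncard_iff (hY'fin.subset Set.sdiff_subset)).mp hrest
    have hqe : q ≠ e := by simpa using hq.2
    have hre : r ≠ e := by simpa using hr.2
    have hse : s ≠ e := by simpa using hs.2
    exact hnq e heY'.1 q hq.1.1 r hr.1.1 s hs.1.1 hqe.symm hre.symm hse.symm hqr hqs hrs
      (hsub hq.1) (hsub hr.1) (hsub hs.1)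
  have h3 : ((C.ncard + 2 : ℕ) : ℕ∞) ≤ ρ := by
    calc ((C.ncard + 2 : ℕ) : ℕ∞) = (hCfin.toFinset.card : ℕ∞) + 2 := by rw [hCcard]; push_cast; ring
      _ ≤ (hCfin.toFinset.card : ℕ∞) + N.eRk Y' := by gcongr
      _ = N.eRk Y := by rw [hrk, add_comm]
      _ ≤ ρ := hρ
  exact_mod_cast h3

/-! ## Series quadruples -/

variable (M : Matroid α) [M.Finite]

omit [M.Finite] in
/-- **`M` has no series quadruple**: no four distinct elements are pairwise parallel in `M✶` (no series class of
`M` has `≥ 4` elements). -/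
def NoSeriesQuad : Prop :=
  ∀ p q r s, p ≠ q → p ≠ r → p ≠ s → q ≠ r → q ≠ s → r ≠ s → M✶.IsNonloop p →
    q ∈ M✶.closure {p} → r ∈ M✶.closure {p} → s ∈ M✶.closure {p} → False

omit [M.Finite] in
/-- **A matroid without a series triple has no series quadruple.** -/
lemma noSeriesQuad_of_noSeriesTriple (hnt : NoSeriesTriple M) : NoSeriesQuad M :=
  fun p q r _ hpq hpr _ hqr _ _ hp hq hr _ => hnt p q r hpq hpr hqr hp hq hr

/-- **A series quadruple gives a series class of `≥ 4` elements.** -/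
lemma four_le_ncard_seriesClass_of_not_noSeriesQuad (hnq : ¬ NoSeriesQuad M) :
    ∃ p ∈ M.E, 4 ≤ (M✶.closure {p}).ncard := by
  unfold NoSeriesQuad at hnq
  simp only [not_forall, not_false_eq_true, exists_prop] at hnq
  obtain ⟨p, q, r, s, hpq, hpr, hps, hqr, hqs, hrs, hp, hq, hr, hs, -⟩ := hnq
  refine ⟨p, by rw [← Matroid.dual_ground]; exact hp.mem_ground, ?_⟩
  have hpP : p ∈ M✶.closure {p} := M✶.mem_closure_of_mem' rfl hp.mem_ground
  have hfin : (M✶.closure {p}).Finite := M.ground_finite.subset (M✶.closure_subset_ground _)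
  have hsub : ({p, q, r, s} : Set α) ⊆ M✶.closure {p} := by
    intro x hx
    rcases hx with rfl | rfl | rfl | hx
    · exact hpP
    · exact hq
    · exact hr
    · rw [Set.mem_singleton_iff] at hx; rw [hx]; exact hs
  have h4 : ({p, q, r, s} : Set α).ncard = 4 := by
    rw [Set.ncard_insert_of_notMem (by simp [hpq, hpr, hps]) (Set.toFinite _),
      Set.ncard_insert_of_notMem (by simp [hqr, hqs]) (Set.toFinite _), Set.ncard_pair hrs]
  calc 4 = ({p, q, r, s} : Set α).ncard := h4.symm
    _ ≤ (M✶.closure {p}).ncard := Set.ncard_le_ncard hsub hfin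

/-! ## The chain for `k ≥ 5` -/

/-- **THE COLOOP BOUND ON A COLOOP-FREE MATROID OF NULLITY `≤ 4` WITHOUT A SERIES QUADRUPLE**: for a bi-independent
`W` with `#E − #W ≥ 7`, at most `2` elements of `E ∖ W` lie in `cl W` (`ncard_coloops_add_two_le_of_no_quad` in
the dual, `ρ = 4`). -/
lemma bound_two_of_no_quad (hcol : ∀ e, ¬ M.IsColoop e) (hν : M✶.eRank ≤ 4) (hnq : NoSeriesQuad M)
    {j : ℕ} {W : Set α} (hW : W ∈ biIndep M j) (hj : j + 7 ≤ M.E.ncard) :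
    {t ∈ M.E \ W | t ∈ M.closure W}.ncard ≤ 2 := by
  rw [compl_closure_eq_dual_coloops M hW]
  have hYE : M.E \ W ⊆ M✶.E := by rw [Matroid.dual_ground]; exact Set.sdiff_subset
  have hcard : (M.E \ W).ncard = M.E.ncard - j := by
    rw [Set.ncard_sdiff' hW.1 M.ground_finite, hW.2.1]
  have h := ncard_coloops_add_two_le_of_no_quad (N := M✶) hYE
    (fun e he => dual_isNonloop_of_coloopFree M hcol he.1)
    (fun p hp q _ r _ s _ hpq hpr hps hqr hqs hrs hqp hrp hsp =>
      hnq p q r s hpq hpr hps hqr hqs hrs (dual_isNonloop_of_coloopFree M hcol hp.1) hqp hrp hsp)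
    (ρ := 4) ((M✶.eRk_le_eRank _).trans hν) (by omega)
  omega

/-- **(↑) AT EVERY LEVEL `k ≥ 5` ON A COLOOP-FREE MATROID OF NULLITY `≤ 4` WITHOUT A SERIES QUADRUPLE**
(`2k + 2 ≤ #E`): the chain with the coloop bound `2` — every level `j ≤ #E − 2 − k` of the chain has complements
of `≥ k + 2 ≥ 7` elements. -/
theorem upAt_of_no_quad (hcol : ∀ e, ¬ M.IsColoop e) (hν : M✶.eRank ≤ 4) (hnq : NoSeriesQuad M) {b : α}
    (hb : b ∈ M.E) {k : ℕ} (hk5 : 5 ≤ k) (hk : 2 * k + 2 ≤ M.E.ncard) : BiIndepUpAt M b k := by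
  refine upAt_of_bound_two M hb (by omega) hk ?_
  intro j hkj hj W hW _
  exact bound_two_of_no_quad M hcol hν hnq hW (by omega)

/-- **(↑) AT LEVEL `5` ON A COLOOP-FREE MATROID OF NULLITY `≤ 4` WITHOUT A SERIES QUADRUPLE** (`12 ≤ #E`). -/
theorem upAt_five_of_no_quad (hcol : ∀ e, ¬ M.IsColoop e) (hν : M✶.eRank ≤ 4) (hnq : NoSeriesQuad M)
    {b : α} (hb : b ∈ M.E) (hn : 12 ≤ M.E.ncard) : BiIndepUpAt M b 5 :=
  upAt_of_no_quad M hcol hν hnq hb le_rfl (by omega)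

end PercRepro
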